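import Literature.NumberTheory.EllipticCurves.Rank1Residual.MuLambdaCarriers
import Literature.NumberTheory.EllipticCurves.Kato2004.DivisibilityInputsZetaLine
import Literature.NumberTheory.EllipticCurves.Kato2004.EulerSystemBoundFineSelmerTwo
import Literature.NumberTheory.EllipticCurves.FineSelmerClassGroupCriterion
import Literature.NumberTheory.EllipticCurves.KatoFineSelmerFiniteProofs
import Literature.NumberTheory.EllipticCurves.Rank1Residual.Predicates
import HarnessLib

/-!
# D-imc-84 v1.1 (cell `bsd-f1-sign2`, seat `-imc` g32/g33, LENS = Iwasawa main conjecture) — crux `SupersingularRankZeroAtTwo`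
# (stmt-BirchSwinnertonDyer-19097, route `ByReductionTypeAtTwo`, K4): **the `(2)`-clause F4@(2) of stub 2's CK♭ package
# is Conjecture A at `2`, image-free** — E1 isolated as a one-curve Prop and DERIVED in the kernel from
# `Rank1Residual.FineMuZeroAt W 2` (pointwise `μ(X₀(E/ℚ_∞)) = 0`), hence from `ConjAAt W 2`, hence (modulo the tree's
# named fact `Lim2017.thm35_at_two_…_of_le_divisionField_four`) from Iwasawa's classical `μ₂ = 0` for ONE subfield
# `L ≤ ℚ(E[4])` of `2`-power index — on the crux's habitat `L = ℚ(x(P))` (the complex/real cubic of `ℚ(E[2])`, `2 = 𝔮³`)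
# or `L = ℚ(x(P), √−1)` (sextic, `2 = 𝔮⁶`, no real place), where ONE odd class number gives `X_∞ = 0` (Iwasawa 1956).

HONEST FRAMING. Crux workfile (`ledger crux write`), THEOREMS + two Props; nothing is asserted about any curve; no
`sorry`; BSD, the crux, Conjecture A are NOT proved.  What is proved: pure `Λ`-algebra (`μ = 0` of a finitely generated
torsion `Λ`-module ⟹ local length `0` at the unique height-one prime `𝔭 ∋ 2`) composed with tree theorems BY NAME.

WHY IT MATTERS FOR THE REGISTRY (`Lines/odd_blind_package.lean` v2.10.1 574c3e468514cf12 / v2.11): stub 2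
`UniformFlatHondaDataAtTwo` carries, inside its `∃ (I Y P loc toX δ Z G), …` package, the clause
`TwoAdicSurjective W → ∀ 𝔭, ht 𝔭 = 1 → C 2 ∈ 𝔭 → lengthAt Λ Y.X 𝔭 ≤ lengthAt Λ (I.H ⧸ Z) 𝔭` («F4@(2)», = Kato 13.4 (3) /
12.5 (4) at the prime `(2)` of `Λ = ℤ₂⟦T⟧`, recorded BEYOND PRINT at `2` by audits K11 / ♭pkg / D-AUDIT-KO06: «ONE theorem-sized
item: the (2)-primary divisibility on ℚ_∞»), and the kernel (`SSFlatRoad.missingUpperBoundAt_two_of_uniformFlat`) branches on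
`TwoAdicSurjective W`, using stub 3 `MuFlatOfNonSurjAtTwo` (`μ(X♭) = 0`) on the other branch.  Since `Y` is the FINE dual and
`(2)` is the only height-one prime containing `2`, the clause says `μ(X₀(E/ℚ_∞)) ≤ μ(𝐇¹/Z)`; it therefore HOLDS, for every
package and WITHOUT any image hypothesis, as soon as `μ(X₀(E/ℚ_∞)) = 0` — statement (A) of Coates–Sujatha at `(E, 2)`.
So F4@(2) is not Euler-system-sized: it is the FINE HALF already typed on the neighbour crux `SignedMuSeedAtTwoPlus`
(stmt-BirchSwinnertonDyer-21438: `CubicMuExact.FineHalfOfCubicMu`, `FineOfOddClassNumber`; census there: 418/497 habitat-type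
complex cubic fields `|d_L| ≤ 2·10⁴` have odd class number, (F) certified on ≥ 493/497), and the SAME classical residual
(Iwasawa's `μ₂`-conjecture for `S₃`-cubic fields) as crux C1″ `FineSelmerConjAAtTwoAdditivePotGood` (stmt-BirchSwinnertonDyer-22615,
`…ConjAAtTwoAdditivePotGoodCurveFreeIff`) and crux C2's cubic Chevalley road (stmt-BirchSwinnertonDyer-22298).
Registry consequence (v2.12 at the earliest, LEAD's call, REF1 to audit): the guard `TwoAdicSurjective W →` of F4@(2) may be
replaced by the displayed input `Rank1Residual.FineMuZeroAt W 2` (or `ConjAAt W 2`), making the clause a THEOREM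
(`fineTwoClause_of_fineMuZeroAt` below) and stub 3 redundant on the rows where that input is certified.

* `FineTwoClauseAt W` — E1 isolated, one curve, IMAGE-FREE: for all cyclotomic data, every finitely generated torsion fine
  dual datum `Y`, every `Λ`-module `M`, every height-one `𝔭 ∋ C 2`: `lengthAt Λ Y.X 𝔭 ≤ lengthAt Λ M 𝔭`.
* `lengthAt_eq_zero_of_muInvariant_eq_zero` — `Λ`-algebra: f.g. torsion `N`, `μ(N) = 0`, `ht 𝔭 = 1`, `C 2 ∈ 𝔭` ⟹ `lengthAt Λ N 𝔭 = 0`.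
* `fineTwoClauseAt_of_fineMuZeroAt` : `FineMuZeroAt W 2 → FineTwoClauseAt W` ★ (the bridge).
* `fineTwoClauseAt_of_conjAAt` : `ConjAAt W 2 → FineTwoClauseAt W` (tree T0 `ConjAAt.fineMuZeroAt`).
* `fineTwoClauseAt_of_classicalMu` : the named fact `Lim2017.thm35_at_two_…four` + ONE subfield `L ≤ ℚ(E[4])` of `2`-power
  index with `μ₂(L^{cyc}) = 0` ⟹ `FineTwoClauseAt W` (CONDITIONAL on the displayed fact; the door the data seat censuses).
* `f4AtTwo_of_fineMuZeroAt` — the clause in the EXACT binder shape of the registry (`I : Kato2004.IwasawaH1Data W 2 κ γ`,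
  `Z : Submodule Λ I.H`, conclusion over `I.H ⧸ Z`), with `TwoAdicSurjective W` ABSENT.
* `ConjAAtTwoOnHabitat` — the census-able candidate Prop of the lens memo §10.117: statement (A) at `2` on the crux's habitat
  (non-CM, analytic rank `0`, good supersingular at `2`); `fineTwoClause_onHabitat_of_conjA` its consequence for F4@(2).

v1.1 (-imc g33, 2026-08-31; riders of REF1-AUDIT-v1 §466 R-84 and the v2.12′ registry cut 1f04c7c9f08aa744): **R466a (naming)** —
`FineTwoClauseAt W` is NOT a weakening of Conjecture A's μ-form, it IS that form: `fineMuZeroAt_of_fineTwoClauseAt` (REF1's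
K466.1: instantiate the «every module `M`» clause at `M := PUnit`, `𝔭 := (2)`) and `fineTwoClauseAt_iff_fineMuZeroAt` (K466.1′)
`FineTwoClauseAt.{0} W ↔ FineMuZeroAt W 2`; what is genuinely WEAKER is the registry's fixed-`M` clause (`M := I.H ⧸ Z`:
`μ_{(2)}(X₀) ≤ μ_{(2)}(𝐇¹/Z)`), which v2.12′ no longer carries at all (stub 3 is now `FineMuZeroOnHabitatAtTwo`, the μ-form itself).
**R466b (binders)** — the torsion binder of `Y.X` is stub 1's `Kato2004_fineSelmerDual_isTorsion`; the finite-generation binder is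
the TREE THEOREM `WeierstrassCurve.FineSelmerDualData.module_finite W κ hγ Y` (as the landed (β′) module
`Theorems/ByReductionTypeAtTwoSupersingularUniformFlatLineFineMu.lean` uses it), so `fineMuZeroAt_iff_forall_muInvariant_eq_zero`
below drops it. **R466c (scope marker)** — `fineTwoClauseAt_of_classicalMu_of_sqrt_neg_one_mem` / `fineMuZeroAt_of_classicalMu_of_sqrt_neg_one_mem`:
the classical door with `√−1 ∈ L` displayed, i.e. `L` totally imaginary = INSIDE the printed scope of the named fact (its
`scope_caveats`: Iwasawa 1973 «k totally imaginary if ℓ = 2»; for `r₁(L) ≥ 2`, e.g. the cubic `ℚ(x(P))` when `Δ_E > 0`, print does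
not supply narrow `μ₂` = wide `μ₂`) — consumers certifying a `Δ_E > 0` row through an odd class number should use `L = ℚ(x(P), √−1)`
(sextic, `2 = 𝔔⁶`), not the totally real cubic.  **Bridge to the registry**: `fineMuZeroOnHabitat_of_conjAOnHabitat :
ConjAAtTwoOnHabitat → ‹body of OddBlindPackage.FineMuZeroOnHabitatAtTwo verbatim›` (v2.12′ stub 3 ⟸ the lens candidate, by name).

References: [CoatesSujatha2005] §3 statement (A), Thm. 3.4; [Lim2017FineSelmer] Thm. 3.5, Lemma 3.2 (arXiv:1306.2047 pp. 6–7);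
[Iwasawa1956] (one totally ramified prime, `p ∤ h`); [Kato2004Asterisque] Thm. 12.5 (4), 13.4 (3), §13.14 (iv) p. 241, §17.13;
[Washington1997] §13.2; tree: `Rank1Residual.FineMuZeroAt/ConjAAt/ConjAAt.fineMuZeroAt` (MuLambdaCarriers),
`Kato2004.eq_augIdealP_of_height_eq_one_of_C_mem`, `muInvariant_eq_toNat_lengthAt`, `lengthAt_ne_top_of_isTorsion`.
PARTITION 52421 = 17880 + 27650 + 3440 + 3451 unchanged; beyond-print theorem: no; BSD not proved; bears_on: stmt-BirchSwinnertonDyer-19097.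
-/

set_option autoImplicit false
set_option linter.dupNamespace false

noncomputable section

open scoped Classical
open WeierstrassCurve PowerSeries
open Literature.NumberTheory.EllipticCurves Literature.NumberTheory.EllipticCurves.Rank1Residual
  Literature.NumberTheory.EllipticCurves.IwasawaAlgebra Literature.NumberTheory.IwasawaTheory ZpExtension

namespace Summit.BirchSwinnertonDyer.BirchSwinnertonDyer.Cruxes.SupersingularRankZeroAtTwo.D84

universe u

/-! ## §1 E1 isolated: the `(2)`-clause, one curve, image-free -/

/-- **`FineTwoClauseAt W` — F4@(2) for ONE curve, IMAGE-FREE.**  For all cyclotomic data `(κ, γ)`, every finitely generated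
torsion fine dual datum `Y` of `W` over `(κ, γ)`, every `Λ`-module `M` and every height-one prime `𝔭 ∋ C 2` of `Λ = ℤ₂⟦T⟧`:
`lengthAt Λ Y.X 𝔭 ≤ lengthAt Λ M 𝔭`.  (With `M := I.H ⧸ Z` this is the registry's clause without `TwoAdicSurjective W →`.)
A predicate; nothing asserted. [cite: Kato2004Asterisque, Thm. 12.5 (4) and Thm. 13.4 (3) at the prime (p)] -/
def FineTwoClauseAt (W : WeierstrassCurve ℚ) [W.IsElliptic] : Prop :=
  ∀ (κ : ZpExtension ℚ 2) (γ : Field.absoluteGaloisGroup ℚ),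
    κ.IsCyclotomic → κ.IsTopGenerator γ → IsCyclotomicVariable 2 γ →
    ∀ (Y : W.FineSelmerDualData κ γ), Module.Finite (IwasawaAlgebra 2) Y.X →
      Module.IsTorsion (IwasawaAlgebra 2) Y.X →
      ∀ (M : Type u) [AddCommGroup M] [Module (IwasawaAlgebra 2) M],
      ∀ 𝔭 : PrimeSpectrum (IwasawaAlgebra 2), 𝔭.asIdeal.height = 1 →
        PowerSeries.C (2 : ℤ_[2]) ∈ 𝔭.asIdeal →
        Module.lengthAt (IwasawaAlgebra 2) Y.X 𝔭 ≤ Module.lengthAt (IwasawaAlgebra 2) M 𝔭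

/-! ## §2 The `Λ`-algebra: `μ = 0` ⟹ local length `0` at the unique height-one prime over `2` -/

section Algebra

variable {p : ℕ} [Fact p.Prime]

/-- **`μ(N) = 0` for a finitely generated torsion `Λ`-module ⟹ `lengthAt Λ N 𝔭 = 0` at every height-one `𝔭 ∋ C p`**
(such a `𝔭` is `(p)`, `Kato2004.eq_augIdealP_of_height_eq_one_of_C_mem`; `μ = (lengthAt at (p)).toNat`,
`muInvariant_eq_toNat_lengthAt`; the length is finite for f.g. torsion, `lengthAt_ne_top_of_isTorsion`). [cite: Washington1997, §13.2] -/
theorem lengthAt_eq_zero_of_muInvariant_eq_zero (N : Type*) [AddCommGroup N] [Module (IwasawaAlgebra p) N]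
    [Module.Finite (IwasawaAlgebra p) N] (hN : Module.IsTorsion (IwasawaAlgebra p) N) (hμ : muInvariant p N = 0)
    (𝔭 : PrimeSpectrum (IwasawaAlgebra p)) (h1 : 𝔭.asIdeal.height = 1)
    (hp : (PowerSeries.C (p : ℤ_[p]) : IwasawaAlgebra p) ∈ 𝔭.asIdeal) :
    Module.lengthAt (IwasawaAlgebra p) N 𝔭 = 0 := by
  have h𝔭 : 𝔭.asIdeal = augIdealP p := Kato2004.eq_augIdealP_of_height_eq_one_of_C_mem 𝔭 h1 hp
  have hne : Module.lengthAt (IwasawaAlgebra p) N 𝔭 ≠ ⊤ := lengthAt_ne_top_of_isTorsion p N hN 𝔭 h𝔭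
  have h := muInvariant_eq_toNat_lengthAt p N 𝔭 h𝔭
  rw [hμ] at h
  rcases (ENat.toNat_eq_zero.mp h.symm) with h0 | htop
  · exact h0
  · exact absurd htop hne

end Algebra

/-! ## §3 The bridge: `FineMuZeroAt W 2 ⟹ F4@(2)` image-free; hence from `ConjAAt W 2`; hence from classical `μ₂ = 0` -/

variable (W : WeierstrassCurve ℚ) [W.IsElliptic]

/-- ★ **`FineMuZeroAt W 2 → FineTwoClauseAt W`**: pointwise `μ(X₀(E/ℚ_∞)) = 0` makes the `(2)`-clause hold for every
package, with NO `2`-adic image hypothesis (`lengthAt Λ Y.X 𝔭 = 0 ≤ _`). [cite: CoatesSujatha2005, §3 statement (A), μ-form] -/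
theorem fineTwoClauseAt_of_fineMuZeroAt (h : FineMuZeroAt W 2) : FineTwoClauseAt.{u} W := by
  intro κ γ hκ hγ hγ' Y hYf hYt M _ _ 𝔭 h1 h2
  haveI : Module.Finite (IwasawaAlgebra 2) Y.X := hYf
  have hμ : muInvariant 2 Y.X = 0 := h κ γ hκ hγ hγ' Y hYf hYt
  rw [lengthAt_eq_zero_of_muInvariant_eq_zero Y.X hYt hμ 𝔭 h1 h2]
  exact zero_le

/-- **`ConjAAt W 2 → FineTwoClauseAt W`** (statement (A) at the pair, via the tree's T0 `ConjAAt.fineMuZeroAt`).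
[cite: CoatesSujatha2005, §3 statement (A)] [cite: Washington1997, §13.2] -/
theorem fineTwoClauseAt_of_conjAAt (hA : ConjAAt W 2) : FineTwoClauseAt.{u} W :=
  fineTwoClauseAt_of_fineMuZeroAt W hA.fineMuZeroAt

/-- **The classical door (CONDITIONAL on the displayed named fact).**  Lim 2017 Thm. 3.5 + Lemma 3.2 at `p = 2`
(`Lim2017.thm35_at_two_fineSelmerDual_moduleFinite_of_classicalMuVanishes_of_le_divisionField_four`, a tree `def … : Prop`
taken as hypothesis) + ONE subfield `L ≤ ℚ(E[4])` of `2`-power index whose cyclotomic `ℤ₂`-extension has `μ = 0`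
⟹ F4@(2) for `W`, image-free.  On the crux's habitat: `L = ℚ(x(P))` (cubic, `[ℚ(E[4]):L]` a power of `2` since
`[ℚ(E[4]):ℚ] ∣ 96`) or `L = ℚ(x(P), √−1)` (no real place — outside the scope caveat «k totally imaginary if ℓ = 2» of
Iwasawa 1973 recorded on the fact); `μ₂(L^{cyc}) = 0` ⟸ `2 ∤ h(L)` by Iwasawa 1956 (`2` totally ramified, one prime).
[cite: Lim2017FineSelmer, Thm. 3.5 and Lemma 3.2] [cite: Iwasawa1973MuInvariants, Thm. 2–3] -/
theorem fineTwoClauseAt_of_classicalMu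
    (hLim2 : Lim2017.thm35_at_two_fineSelmerDual_moduleFinite_of_classicalMuVanishes_of_le_divisionField_four)
    (L : IntermediateField ℚ (AlgebraicClosure ℚ)) (hL : L ≤ W.divisionField 4)
    (hidx : ∃ k : ℕ, Module.finrank ℚ (W.divisionField 4) = 2 ^ k * Module.finrank ℚ L)
    (hμL : ∀ κL : ZpExtension L 2, κL.IsCyclotomic → ClassicalMuVanishes κL) : FineTwoClauseAt.{u} W :=
  fineTwoClauseAt_of_conjAAt W (fun κ hκ ↦ hLim2 W L hL hidx hμL κ hκ)

/-! ## §4 The clause in the registry's exact binder shape, `TwoAdicSurjective W` absent -/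

/-- **F4@(2) in the binder shape of `Lines/odd_blind_package.lean` stub 2** (`I : Kato2004.IwasawaH1Data W 2 κ γ`,
`Y : W.FineSelmerDualData κ γ`, `Z : Submodule Λ I.H`, conclusion over `I.H ⧸ Z`), from `FineMuZeroAt W 2`, for a finitely
generated torsion `Y` (torsion: stub 1's `Kato2004_fineSelmerDual_isTorsion`, Kato Thm. 12.4 (3) at `2`; finite generation: the
tree theorem `WeierstrassCurve.FineSelmerDualData.module_finite` — v1.1 R466b) — NO image hypothesis.
[cite: Kato2004Asterisque, Thm. 13.4 (3) (shape), Thm. 12.4] -/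
theorem f4AtTwo_of_fineMuZeroAt (h : FineMuZeroAt W 2) (κ : ZpExtension ℚ 2) (γ : Field.absoluteGaloisGroup ℚ)
    (hκ : κ.IsCyclotomic) (hγ : κ.IsTopGenerator γ) (hγ' : IsCyclotomicVariable 2 γ)
    [ContinuousSMul ℤ_[2] (W.tateModule 2)] (I : Kato2004.IwasawaH1Data W 2 κ γ) (Y : W.FineSelmerDualData κ γ)
    (Z : Submodule (IwasawaAlgebra 2) I.H) (hYf : Module.Finite (IwasawaAlgebra 2) Y.X)
    (hYt : Module.IsTorsion (IwasawaAlgebra 2) Y.X) :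
    ∀ 𝔭 : PrimeSpectrum (IwasawaAlgebra 2), 𝔭.asIdeal.height = 1 → PowerSeries.C (2 : ℤ_[2]) ∈ 𝔭.asIdeal →
      Module.lengthAt (IwasawaAlgebra 2) Y.X 𝔭 ≤ Module.lengthAt (IwasawaAlgebra 2) (I.H ⧸ Z) 𝔭 :=
  fun 𝔭 h1 h2 ↦ fineTwoClauseAt_of_fineMuZeroAt W h κ γ hκ hγ hγ' Y hYf hYt (I.H ⧸ Z) 𝔭 h1 h2

/-! ## §5 The census-able candidate of the lens memo (§10.117): statement (A) at `2` on the crux's habitat -/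

/-- **IMC-84 candidate `ConjAAtTwoOnHabitat`** — Coates–Sujatha (A) at `p = 2` for every non-CM, analytic-rank-`0`, good
supersingular-at-`2` curve (the habitat of crux 19097).  CONJECTURE (class-wide = Iwasawa's `μ₂`-conjecture for the cubic /
sextic fields `ℚ(x(P))`, `ℚ(x(P), √−1)` realised by the habitat); certificate-shaped PER ROW (`2 ∤ h`). BC5 witness = the data
seat's class-number parity table (ask D-imc-84) + crux 21438's census (418/497). Nothing asserted.
[cite: CoatesSujatha2005, §3 Conjecture A] [cite: Lim2017FineSelmer, Thm. 3.5] -/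
def ConjAAtTwoOnHabitat : Prop :=
  ∀ (W : WeierstrassCurve ℚ) [W.IsElliptic] [W.IsGloballyMinimal],
    ¬ W.HasCM → W.analyticRank = 0 → GoodSS W 2 → ConjAAt W 2

/-- The candidate's consequence for the registry: F4@(2) image-free on the whole habitat. -/
theorem fineTwoClause_onHabitat_of_conjA (h : ConjAAtTwoOnHabitat) (W : WeierstrassCurve ℚ) [W.IsElliptic]
    [W.IsGloballyMinimal] (hCM : ¬ W.HasCM) (hr : W.analyticRank = 0) (hss : GoodSS W 2) : FineTwoClauseAt.{u} W :=
  fineTwoClauseAt_of_conjAAt W (h W hCM hr hss)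

/-! ## §6 (v1.1) R466a: the isolate IS the μ-form — converse bridge and the `iff`; R466b: the f.g. binder is a tree theorem -/

/-- **`FineTwoClauseAt.{0} W → FineMuZeroAt W 2`** (REF1-AUDIT-v1 §466 K466.1, re-proved here): the image-free clause for EVERY
module `M` forces `μ(X₀(E/ℚ_∞)) = 0` — take `M := PUnit` (local length `0`, `Module.lengthAt_eq_zero_of_subsingleton`) at the
height-one prime `𝔭 := (2) = augIdealP 2` (`height_augIdealP_holds`, `isPrime_augIdealP_holds`), and read `μ = (lengthAt at (2)).toNat`
(`muInvariant_eq_toNat_lengthAt`). [cite: Washington1997, §13.2] -/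
theorem fineMuZeroAt_of_fineTwoClauseAt (h : FineTwoClauseAt.{0} W) : FineMuZeroAt W 2 := by
  intro κ γ hκ hγ hγ' Y hYf hYt
  let 𝔭 : PrimeSpectrum (IwasawaAlgebra 2) := ⟨augIdealP 2, isPrime_augIdealP_holds 2⟩
  have h1 : 𝔭.asIdeal.height = 1 := height_augIdealP_holds 2
  have h2 : PowerSeries.C (2 : ℤ_[2]) ∈ 𝔭.asIdeal := by
    show PowerSeries.C (2 : ℤ_[2]) ∈ augIdealP 2
    have : ((2 : ℕ) : ℤ_[2]) = (2 : ℤ_[2]) := by norm_num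
    rw [augIdealP, this]
    exact Ideal.subset_span (Set.mem_singleton _)
  have hle := h κ γ hκ hγ hγ' Y hYf hYt PUnit.{1} 𝔭 h1 h2
  have h0 : Module.lengthAt (IwasawaAlgebra 2) PUnit.{1} 𝔭 = 0 := Module.lengthAt_eq_zero_of_subsingleton 𝔭
  rw [h0] at hle
  have hz : Module.lengthAt (IwasawaAlgebra 2) Y.X 𝔭 = 0 := nonpos_iff_eq_zero.mp hle
  rw [muInvariant_eq_toNat_lengthAt 2 Y.X 𝔭 rfl, hz]
  rfl

/-- **R466a: `FineTwoClauseAt.{0} W ↔ FineMuZeroAt W 2`** — E1 isolated image-free IS Conjecture A's μ-form at `(E, 2)` (REF1 K466.1′).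
[cite: CoatesSujatha2005, §3 statement (A), μ-form] -/
theorem fineTwoClauseAt_iff_fineMuZeroAt : FineTwoClauseAt.{0} W ↔ FineMuZeroAt W 2 :=
  ⟨fineMuZeroAt_of_fineTwoClauseAt W, fineTwoClauseAt_of_fineMuZeroAt W⟩

/-- **R466b: the finite-generation binder of `FineMuZeroAt` is idle** — `Module.Finite Λ Y.X` is the tree theorem
`WeierstrassCurve.FineSelmerDualData.module_finite W κ hγ Y`; so `μ(X₀) = 0` may be read with the torsion binder alone.
[cite: Kato2004Asterisque, Thm. 12.4 (3) (torsion of the fine dual)] -/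
theorem fineMuZeroAt_iff_forall_muInvariant_eq_zero : FineMuZeroAt W 2 ↔
    ∀ (κ : ZpExtension ℚ 2) (γ : Field.absoluteGaloisGroup ℚ), κ.IsCyclotomic → κ.IsTopGenerator γ →
      IsCyclotomicVariable 2 γ → ∀ (Y : W.FineSelmerDualData κ γ),
        Module.IsTorsion (IwasawaAlgebra 2) Y.X → muInvariant 2 Y.X = 0 :=
  ⟨fun h κ γ hκ hγ hγ' Y hYt ↦ h κ γ hκ hγ hγ' Y (WeierstrassCurve.FineSelmerDualData.module_finite W κ hγ Y) hYt,
    fun h κ γ hκ hγ hγ' Y _ hYt ↦ h κ γ hκ hγ hγ' Y hYt⟩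

/-! ## §7 (v1.1) R466c: the classical door with the scope marker `√−1 ∈ L` displayed (totally imaginary `L` = print scope) -/

/-- **The classical door, SCOPE-MARKED** (`√−1 ∈ L`, so `L` has no real place and lies INSIDE the printed scope of the named fact —
see its `scope_caveats`: Iwasawa 1973 Thm. 2–3 «let k be totally imaginary if ℓ = 2»).  On the habitat use `L = ℚ(x(P), √−1)`
(sextic, `2 = 𝔔⁶`, `[ℚ(E[4]) : L]` a power of `2`); `μ₂(L^{cyc}) = 0 ⟸ 2 ∤ h(L)` (Iwasawa 1956).  The marker `hi` is consumed
only as a restriction on instantiation (the proof is `fineTwoClauseAt_of_classicalMu`).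
[cite: Lim2017FineSelmer, Thm. 3.5 and Lemma 3.2] [cite: Iwasawa1973MuInvariants, Thm. 2–3 and §4 (k′ = k(√−1))] -/
theorem fineTwoClauseAt_of_classicalMu_of_sqrt_neg_one_mem
    (hLim2 : Lim2017.thm35_at_two_fineSelmerDual_moduleFinite_of_classicalMuVanishes_of_le_divisionField_four)
    (L : IntermediateField ℚ (AlgebraicClosure ℚ)) (hi : ∃ i ∈ L, i * i = -1) (hL : L ≤ W.divisionField 4)
    (hidx : ∃ k : ℕ, Module.finrank ℚ (W.divisionField 4) = 2 ^ k * Module.finrank ℚ L)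
    (hμL : ∀ κL : ZpExtension L 2, κL.IsCyclotomic → ClassicalMuVanishes κL) : FineTwoClauseAt.{u} W := by
  obtain ⟨_, _, _⟩ := hi
  exact fineTwoClauseAt_of_classicalMu W hLim2 L hL hidx hμL

/-- **The same door read as `μ(X₀(E/ℚ_∞)) = 0`** (what v2.12′'s stub 3 `FineMuZeroOnHabitatAtTwo` asks per curve), scope-marked.
[cite: Lim2017FineSelmer, Thm. 3.5 and Lemma 3.2] [cite: CoatesSujatha2005, §3 statement (A)] -/
theorem fineMuZeroAt_of_classicalMu_of_sqrt_neg_one_mem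
    (hLim2 : Lim2017.thm35_at_two_fineSelmerDual_moduleFinite_of_classicalMuVanishes_of_le_divisionField_four)
    (L : IntermediateField ℚ (AlgebraicClosure ℚ)) (hi : ∃ i ∈ L, i * i = -1) (hL : L ≤ W.divisionField 4)
    (hidx : ∃ k : ℕ, Module.finrank ℚ (W.divisionField 4) = 2 ^ k * Module.finrank ℚ L)
    (hμL : ∀ κL : ZpExtension L 2, κL.IsCyclotomic → ClassicalMuVanishes κL) : FineMuZeroAt W 2 := by
  obtain ⟨_, _, _⟩ := hi
  exact ConjAAt.fineMuZeroAt (fun κ hκ ↦ hLim2 W L hL hidx hμL κ hκ)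

/-! ## §8 (v1.1) Bridge to the registry v2.12′: the lens candidate ⟹ stub 3 `FineMuZeroOnHabitatAtTwo`, by name -/

/-- **`ConjAAtTwoOnHabitat → ‹body of OddBlindPackage.FineMuZeroOnHabitatAtTwo›`** (`Lines/odd_blind_package.lean` v2.12′
1f04c7c9f08aa744 ll.1486–1489, spelled with the registry's fully qualified `FineMuZeroAt`): the census-able candidate of the lens memo
closes stub 3 of the registered line (T0 `ConjAAt.fineMuZeroAt`, tree).  Nothing asserted: the candidate is a CONJECTURE class-wide.
[cite: CoatesSujatha2005, §3 statement (A)] -/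
theorem fineMuZeroOnHabitat_of_conjAOnHabitat (h : ConjAAtTwoOnHabitat) :
    ∀ (W : WeierstrassCurve ℚ) [W.IsElliptic] [W.IsGloballyMinimal],
      ¬ W.HasCM → W.analyticRank = 0 → GoodSS W 2 →
        Literature.NumberTheory.EllipticCurves.Rank1Residual.FineMuZeroAt W 2 :=
  fun W _ _ hCM hr hss ↦ (h W hCM hr hss).fineMuZeroAt

end Summit.BirchSwinnertonDyer.BirchSwinnertonDyer.Cruxes.SupersingularRankZeroAtTwo.D84

end
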